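/-
Copyright (c) 2026 the pub-hodgecm-mathlib formalisation cell (harness21).  Prover seat hodgecm-mathlib-K2Liu-p12 (g2): Track B «K2-LIT»,
#184♮ = hLiu418 = stmt-HodgeConjecture-24832; Road Φ of socket #41, organ Φ4-EXACT (LEAD F0P6-plan ruling «M-157p»), file E5.
-/
import Summits.HodgeConjecture.HodgeConjecture.Theorems.K2LiuSkewDetLevelSetVanishing   -- ★ E2c (hence E0–E2b, E1b): the ten lattice integrals
import Summits.HodgeConjecture.HodgeConjecture.Theorems.K2LiuGoodPlaceWhittakerUnitBall   -- ★ X2: the unit-ball contribution is the volume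
import HarnessLib

/-!
# Crux `HLiu418`, Road Φ of socket #41, organ Φ4-EXACT — FILE E5: THE UNIMODULAR VALUE OF THE UNRAMIFIED WHITTAKER COEFFICIENT (assembly engine)

Cell `hodgecm-mathlib`, crux item hLiu418 = `stmt-HodgeConjecture-24832`, route of record `HCCMUnconditional`; squad K2 ∕ K2Liu, road `K2_Liu`,
socket #41 `sig_K2LiuSiegelEisensteinContinuation`, Road Φ, organ Φ4-EXACT (ruling M-157p; method memo `K2/K2Liu-p12/g2/CENSUS-PHI4-EXACT-Method.K2Liu-p12-g2.md`).
THEOREMS ONLY (no `def`, no `instance`, no `notation`, no named-fact hypothesis, no `sorry`); lane `--supports stmt-HodgeConjecture-24832`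
(count-neutral helper; closes no socket by itself).

THE STATEMENT.  `n = 2`; a good UNRAMIFIED place `v` (`|2|_w = 1`, `v_w(ι_w ϖ) = exp(−1)` at every `w ∣ v`, `T₀, T₀⁻¹` integral, an anti-invariant
unit `ε` with `|2ε|_w = 1`, `χ_w` unramified, `ψ_v` of conductor exponent `0`, `τ` the trace-type functional); `φ_s` the spherical section of
`I_v(s,χ_v)`; `β` a `T`-skew Fourier index UNIMODULAR at `v` (`ββ⁻ = 1`, `β, β⁻` integral).  Write `t := (∏_w χ_w(ι_w ϖ))·(∏_w ‖ι_w ϖ‖_w)^{s+1}`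
and `μ₀ := μ(B(0))`.  GIVEN BY VALUE the residue-quadric value **`I(1,1) = ∫_{B(−1) ∩ D(1)} ψ_v(−τ tr(βt)) dμ = C·μ₀`** (`C = +q_v` at an INERT place —
file E3; `C = −q_v` at a SPLIT place — K2Liu-p10's `K2LiuSkewResidueQuadricSplit`), the unramified local Whittaker coefficient is
  **`∫_{B(−3)} φ_s(w_Δ n t) ψ_v(−τ tr(βt)) dμ(t) = μ₀ · (1 − t)(1 + C t)`**,
i.e. `μ₀(1−t)(1−η_v q_v t)`; with the CM letters `α_v = η_v`, `∏_w ‖ι_w ϖ‖_w = q_v^{−2}` this is `μ₀(1 − q_v^{−(2s+1)})(1 − η_v q_v^{−(2s+2)}) = μ₀·b_v(s)⁻¹`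
(★ O41.6 letters; G2's `hP1`).  ASSEMBLY: `∫_{B(−3)} = ∫_{B(0)} + Σ_{k=1}^{3} ∫_{Sh(k)}` (★ E1b); `∫_{B(0)} = μ₀` (★ X2); each shell integral is
`t^k H(k,k) + Σ_m t^m (H(k,m) − H(k,m−1))` (★ E1b strata) with `H(k,m) = I(k,m) − I(k−1,m)` (★ E1b §4); `I(0,m) = μ₀`, `I(1,1) = Cμ₀`, all other
`I(k,m) = 0` (★ E2c) — and the polynomial collapses to `μ₀(1 + (C−1)t − C t²)`.

## References
* [Shimura1997] G. Shimura, *Euler Products and Eisenstein Series*, CBMS 93 (1997), Thm. 13.6, Prop. 14.9, §18–§19.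
* [KudlaSweet1997] S. Kudla, W. J. Sweet, Israel J. Math. 98 (1997), §1.   * [Liu2011] Y. Liu, Algebra Number Theory 5 (2011), §2A (2-2), (2-10).
* [Casselman1980] W. Casselman, Compositio Math. 40 (1980), §3.   * [KudlaRallis1994] S. Kudla, S. Rallis, Ann. of Math. 140 (1994), §2.
-/

set_option autoImplicit false
-- the mandated namespace repeats the single-problem summit's segment (`HodgeConjecture.HodgeConjecture`)
set_option linter.dupNamespace false

noncomputable section

open scoped NNReal ENNReal Matrix Topology
open NumberField IsDedekindDomain Matrix MeasureTheory Set Filter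
open Literature.NumberTheory.Automorphic Literature.NumberTheory.Automorphic.UnitaryGroup
open Literature.NumberTheory.GelbartRogawski1991.AdaptedBlocks
open Literature.NumberTheory.GelbartRogawski1991.UnitaryDualPair.LocalSplitting
open Literature.NumberTheory.K2Lit.LocalSiegelDoubled
open Summit.HodgeConjecture.HodgeConjecture.Cruxes.HLiu418.K2LiuLocalRingValuationBalls
open Summit.HodgeConjecture.HodgeConjecture.Cruxes.HLiu418.K2LiuSkewLatticeShells
open Summit.HodgeConjecture.HodgeConjecture.Cruxes.HLiu418.K2LiuBadPlaceWhittakerHeads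
open Summit.HodgeConjecture.HodgeConjecture.Cruxes.HLiu418.K2LiuWhittakerContentStrata
open Summit.HodgeConjecture.HodgeConjecture.Cruxes.HLiu418.K2LiuSkewDetLevelSetVanishing
open Summit.HodgeConjecture.HodgeConjecture.Cruxes.HLiu418.K2LiuGoodPlaceWhittakerUnitBall

namespace Summit.HodgeConjecture.HodgeConjecture.Cruxes.HLiu418.K2LiuGoodPlaceWhittakerUnimodularValue

variable (F : Type) [Field F] [NumberField F] (E : Type) [Field E] [NumberField E] [Algebra F E]
  [Algebra.IsQuadraticExtension F E] (c : E ≃ₐ[F] E) {δ : E} (hcδ : c δ = -δ) (hδ : δ ≠ 0) {dd : F} (hd : δ * δ = algebraMap F E dd)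
  (v : HeightOneSpectrum (𝓞 F)) {T₀ : Matrix (Fin 2) (Fin 2) F}
  (hT₀ : T₀.IsSymm) (hT₀d : IsUnit T₀.det)
  {JD : Matrix (Fin (2 + 2)) (Fin (2 + 2)) E} (hJD : JD = (gramD F 2 T₀).map (algebraMap F E))
  {π : v.adicCompletion F} (hπ : Valued.v π = WithZero.exp (-1 : ℤ)) (hπw : ∀ w : PlacesOver E v, Valued.v (toPlace v w π) = WithZero.exp (-1 : ℤ))

include hcδ hδ hd hT₀ hT₀d hJD hπ hπw in
/-- **THE UNIMODULAR VALUE OF THE UNRAMIFIED WHITTAKER COEFFICIENT (rank two), assembly engine.**  At a good unramified place, for the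
spherical section `φ_s` (`χ_w` unramified), `ψ_v` of conductor `0`, and a `v`-unimodular `T`-skew `β`: given the residue-quadric value
`∫_{B(−1) ∩ D(1)} ψ_v(−τ tr(βt)) dμ = C·μ(B(0))` BY VALUE,
`∫_{B(−3)} φ_s(w_Δ n(t))·ψ_v(−τ tr(βt)) dμ(t) = μ(B(0))·(1 − t)(1 + C t)`, `t = (∏_w χ_w(ι_w ϖ))·(∏_w ‖ι_w ϖ‖_w)^{s+1}`
(`C = −η_v q_v`: the local factor `b_v(s)⁻¹` of ★ O41.6 in the CM letters).
[cite: Shimura1997, Thm. 13.6] [cite: KudlaSweet1997, §1] [cite: Liu2011, §2A (2-2)] [cite: Casselman1980, §3] -/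
theorem setIntegral_whittaker_unimodular_eq
    (S : AddSubgroup (Matrix (Fin 2) (Fin 2) (LocalRing E v)))
    (hS : ∀ t, t ∈ S ↔ (t.map (conjLocal E c v))ᵀ * gramS F E v 2 T₀ + gramS F E v 2 T₀ * t = 0)
    [MeasurableSpace S] [BorelSpace S] (μ : Measure S) [μ.IsAddHaarMeasure]
    (h2v : ∀ w : PlacesOver E v, ValuativeRel.valuation (w.1.adicCompletion E) (2 : w.1.adicCompletion E) = 1)
    (hT : ∀ (w : PlacesOver E v) (i j : Fin 2),
      ValuativeRel.valuation (w.1.adicCompletion E) (algebraMap E (w.1.adicCompletion E) (algebraMap F E (T₀ i j))) ≤ 1)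
    (hTinv : ∀ (w : PlacesOver E v) (i j : Fin 2),
      ValuativeRel.valuation (w.1.adicCompletion E) (algebraMap E (w.1.adicCompletion E) (algebraMap F E (T₀⁻¹ i j))) ≤ 1)
    (hTb : ∀ i j (w : PlacesOver E v), Valued.v (gramS F E v 2 T₀ i j w) ≤ Valued.v (toPlace v w π) ^ (0 : ℤ))
    (hTib : ∀ i j (w : PlacesOver E v), Valued.v ((gramS F E v 2 T₀)⁻¹ i j w) ≤ Valued.v (toPlace v w π) ^ (0 : ℤ))
    {χv : ∀ w : PlacesOver E v, (w.1.adicCompletion E)ˣ →* ℂˣ}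
    (hχur : ∀ (w : PlacesOver E v) (x : (w.1.adicCompletion E)ˣ), Valued.v (x : w.1.adicCompletion E) = 1 → χv w x = 1)
    (hϖ0 : ∀ w : PlacesOver E v, toPlace v w π ≠ 0)
    {s : ℂ} {φs : UnitaryGroup.localPi E c (2 + 2) JD v → ℂ} (hφ : IsSphericalSection F E c hcδ hδ hd v 2 hT₀ hJD χv s φs)
    {ψ : AddChar (v.adicCompletion F) Circle} (hψ : Continuous ψ) (hdψ : ψ.HasConductorExp 0)
    {τ : LocalRing E v → v.adicCompletion F} (hτ : ∀ r, toLocalRing E v (τ r) = r + conjLocal E c v r) (hτadd : ∀ r s, τ (r + s) = τ r + τ s)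
    (hτs : ∀ (z : v.adicCompletion F) (r : LocalRing E v), τ (toLocalRing E v z * r) = z * τ r) (hτc : Continuous τ)
    (h2F : Valued.v (2 : v.adicCompletion F) = 1)
    {ε : LocalRing E v} (hεσ : conjLocal E c v ε = -ε) (hεint : ∀ w : PlacesOver E v, Valued.v (ε w) ≤ 1)
    (hε : ∀ w : PlacesOver E v, Valued.v (toPlace v w π) ^ (0 : ℤ) ≤ Valued.v ((2 * ε) w))
    (h2 : ∀ w : PlacesOver E v, Valued.v (toPlace v w π) ^ (0 : ℤ) ≤ Valued.v ((2 : LocalRing E v) w))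
    {β βinv : Matrix (Fin 2) (Fin 2) (LocalRing E v)} (hβs : (β.map (conjLocal E c v))ᵀ * gramS F E v 2 T₀ + gramS F E v 2 T₀ * β = 0)
    (hββ : β * βinv = 1) (hβ0 : ∀ i j (w : PlacesOver E v), Valued.v (β i j w) ≤ Valued.v (toPlace v w π) ^ (0 : ℤ))
    (hβinv0 : ∀ i j (w : PlacesOver E v), Valued.v (βinv i j w) ≤ Valued.v (toPlace v w π) ^ (0 : ℤ))
    (C : ℂ) (hI11 : ∫ t in {t : S | ∀ i j (w : PlacesOver E v), Valued.v (t.1 i j w) ≤ Valued.v (toPlace v w π) ^ (-1 : ℤ)} ∩ {t : S | ∀ w : PlacesOver E v, Valued.v (t.1.det w) ≤ Valued.v (toPlace v w π) ^ (-1 : ℤ)}, ((ψ (-τ (Matrix.trace (β * t.1))) : Circle) : ℂ) ∂μ =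
      C * (μ.real {t : S | ∀ i j (w : PlacesOver E v), Valued.v (t.1 i j w) ≤ Valued.v (toPlace v w π) ^ (0 : ℤ)} : ℂ)) :
    ∫ t in {t : S | ∀ i j (w : PlacesOver E v), Valued.v (t.1 i j w) ≤ Valued.v (toPlace v w π) ^ (-3 : ℤ)},
        φs (weylDelta F E c v 2 hJD * nElem F E c v 2 hJD t.1 ((hS t.1).1 t.2)) * ((ψ (-τ (Matrix.trace (β * t.1))) : Circle) : ℂ) ∂μ =
      (μ.real {t : S | ∀ i j (w : PlacesOver E v), Valued.v (t.1 i j w) ≤ Valued.v (toPlace v w π) ^ (0 : ℤ)} : ℂ) *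
        ((1 - ((((∏ w : PlacesOver E v, χv w (Units.mk0 (toPlace v w π) (hϖ0 w))) : ℂˣ) : ℂ) *
          (((∏ w : PlacesOver E v, ‖toPlace v w π‖) : ℝ) : ℂ) ^ (s + 1))) *
          (1 + C * ((((∏ w : PlacesOver E v, χv w (Units.mk0 (toPlace v w π) (hϖ0 w))) : ℂˣ) : ℂ) *
          (((∏ w : PlacesOver E v, ‖toPlace v w π‖) : ℝ) : ℂ) ^ (s + 1)))) := by
  -- regularity and integrability of the integrand on balls
  have hfc : Continuous φs :=
    continuous_of_rightInvariant (UnitaryGroup.isOpen_localInt E c (2 + 2) JD v) fun g k hk => hφ.apply_mul_of_mem_localInt hk g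
  have hφm : Measurable fun t : S => φs (weylDelta F E c v 2 hJD * nElem F E c v 2 hJD t.1 ((hS t.1).1 t.2)) :=
    measurable_pullback F E c v 2 hJD S hS hfc
  have hχc : Continuous fun t : S => ((ψ (-τ (Matrix.trace (β * t.1))) : Circle) : ℂ) :=
    continuous_subtype_val.comp (hψ.comp (hτc.comp (continuous_const.matrix_mul continuous_subtype_val).matrix_trace).neg)
  have hχ1 : ∀ t : S, ‖((ψ (-τ (Matrix.trace (β * t.1))) : Circle) : ℂ)‖ ≤ 1 := fun t => by rw [Circle.norm_coe]
  have hfi : ∀ a : ℤ, IntegrableOn (fun t : S => φs (weylDelta F E c v 2 hJD * nElem F E c v 2 hJD t.1 ((hS t.1).1 t.2)) *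
      ((ψ (-τ (Matrix.trace (β * t.1))) : Circle) : ℂ)) {t : S | ∀ i j (w : PlacesOver E v), Valued.v (t.1 i j w) ≤ Valued.v (toPlace v w π) ^ a} μ := by
    intro a
    obtain ⟨Cb, hCb⟩ := exists_bound_pullback_of_isCompact F E c v 2 hJD S hS hfc (isCompact_ball F E c v hπ 2 S hS a)
    exact integrableOn_mul_of_bound μ (measurableSet_ball F E v hπ 2 S a) (measure_ball_ne_top F E c v hπ 2 S hS μ a) hφm hχc.measurable hχ1 hCb
  -- the character integral over the unit ball (and over `B(0) ∩ D(m)`, `m ≥ 0`) is the volume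
  have hχB0 : ∀ m : ℤ, 0 ≤ m → ∫ t in {t : S | ∀ i j (w : PlacesOver E v), Valued.v (t.1 i j w) ≤ Valued.v (toPlace v w π) ^ (0 : ℤ)} ∩ {t : S | ∀ w : PlacesOver E v, Valued.v (t.1.det w) ≤ Valued.v (toPlace v w π) ^ (-m)}, ((ψ (-τ (Matrix.trace (β * t.1))) : Circle) : ℂ) ∂μ =
      (μ.real {t : S | ∀ i j (w : PlacesOver E v), Valued.v (t.1 i j w) ≤ Valued.v (toPlace v w π) ^ (0 : ℤ)} : ℂ) := by
    intro m hm
    have hsub : {t : S | ∀ i j (w : PlacesOver E v), Valued.v (t.1 i j w) ≤ Valued.v (toPlace v w π) ^ (0 : ℤ)} ∩ {t : S | ∀ w : PlacesOver E v, Valued.v (t.1.det w) ≤ Valued.v (toPlace v w π) ^ (-m)} = {t : S | ∀ i j (w : PlacesOver E v), Valued.v (t.1 i j w) ≤ Valued.v (toPlace v w π) ^ (0 : ℤ)} := by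
      refine inter_eq_left.2 fun t ht w => ?_
      have h1 := det_mem_ball_two F E v hπ (X := t.1) ht w
      rw [add_zero] at h1
      exact h1.trans (zpow_le_zpow_right_of_le_one₀ (zero_lt_iff.2 (valued_toPlace_uniformizer_ne_zero F E v hπ w))
        (valued_toPlace_uniformizer_le_one F E v hπ w) (by omega))
    rw [hsub, setIntegral_congr_fun (measurableSet_ball F E v hπ 2 S 0) (fun t ht => ?_), setIntegral_const, Complex.real_smul, mul_one]
    have hmem : -τ (Matrix.trace (β * t.1)) ∈ primePowBall (v.adicCompletion F) 0 := by
      refine neg_mem_primePowBall ?_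
      have h := tau_mem_primePowBall F E c v hπ hτ (ball_trace F E v (mball_mul F E v hπ hβ0 ht))
      rwa [show (0 : ℤ) + 0 = 0 by ring] at h
    rw [hdψ.1 _ hmem, Circle.coe_one]
  -- Step 1: `∫_{B(−3)} = ∫_{B(0)} + ∫_{Sh 1} + ∫_{Sh 2} + ∫_{Sh 3}`
  have e3 := setIntegral_ball_eq_add_shell F E v hπ S μ (k := 3) (hfi _)
  rw [show (-(3 : ℤ) + 1) = (-2 : ℤ) by norm_num] at e3
  have e2 := setIntegral_ball_eq_add_shell F E v hπ S μ (k := 2) (hfi _)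
  rw [show (-(2 : ℤ) + 1) = (-1 : ℤ) by norm_num] at e2
  have e1 := setIntegral_ball_eq_add_shell F E v hπ S μ (k := 1) (hfi _)
  rw [show (-(1 : ℤ) + 1) = (0 : ℤ) by norm_num] at e1
  -- Step 2: the unit ball (★ X2)
  have e0 := setIntegral_unitBall_eq_measureReal F E c hcδ hδ hd v 2 hT₀ hJD hπ S hS μ h2v hφ hdψ le_rfl hτ hβ0
  -- Step 3: strata of the three shells (★ E1b)
  have s1 := setIntegral_shell_eq_strata F E c hcδ hδ hd v hT₀ hT₀d hJD hπ hπw S hS μ h2v hT hTinv hχur hϖ0 hφ hψ hτc β 1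
  have s2 := setIntegral_shell_eq_strata F E c hcδ hδ hd v hT₀ hT₀d hJD hπ hπw S hS μ h2v hT hTinv hχur hϖ0 hφ hψ hτc β 2
  have s3 := setIntegral_shell_eq_strata F E c hcδ hδ hd v hT₀ hT₀d hJD hπ hπw S hS μ h2v hT hTinv hχur hϖ0 hφ hψ hτc β 3
  rw [show Finset.Ioc 1 (2 * 1) = {2} by decide, Finset.sum_singleton] at s1
  rw [show Finset.Ioc 2 (2 * 2) = {3, 4} by decide, Finset.sum_pair (by norm_num)] at s2
  rw [show Finset.Ioc 3 (2 * 3) = insert 4 {5, 6} by decide, Finset.sum_insert (by decide), Finset.sum_pair (by norm_num)] at s3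
  simp only [Nat.cast_ofNat, Nat.cast_one, Nat.reduceSub, Int.reduceNeg, Int.reduceAdd] at s1 s2 s3 e1 e2 e3
  -- Step 4: `H(k,m) = I(k,m) − I(k−1,m)` (★ E1b §4)
  have j11 := setIntegral_shell_inter_eq_sub F E c v hπ S hS μ (measurableSet_detLevel F E v hπ S (-1 : ℤ)) hχc.measurable hχ1 1
  rw [show (-(1 : ℤ) + 1) = (0 : ℤ) by norm_num] at j11
  have j12 := setIntegral_shell_inter_eq_sub F E c v hπ S hS μ (measurableSet_detLevel F E v hπ S (-2 : ℤ)) hχc.measurable hχ1 1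
  rw [show (-(1 : ℤ) + 1) = (0 : ℤ) by norm_num] at j12
  have j22 := setIntegral_shell_inter_eq_sub F E c v hπ S hS μ (measurableSet_detLevel F E v hπ S (-2 : ℤ)) hχc.measurable hχ1 2
  rw [show (-(2 : ℤ) + 1) = (-1 : ℤ) by norm_num] at j22
  have j23 := setIntegral_shell_inter_eq_sub F E c v hπ S hS μ (measurableSet_detLevel F E v hπ S (-3 : ℤ)) hχc.measurable hχ1 2
  rw [show (-(2 : ℤ) + 1) = (-1 : ℤ) by norm_num] at j23
  have j24 := setIntegral_shell_inter_eq_sub F E c v hπ S hS μ (measurableSet_detLevel F E v hπ S (-4 : ℤ)) hχc.measurable hχ1 2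
  rw [show (-(2 : ℤ) + 1) = (-1 : ℤ) by norm_num] at j24
  have j33 := setIntegral_shell_inter_eq_sub F E c v hπ S hS μ (measurableSet_detLevel F E v hπ S (-3 : ℤ)) hχc.measurable hχ1 3
  rw [show (-(3 : ℤ) + 1) = (-2 : ℤ) by norm_num] at j33
  have j34 := setIntegral_shell_inter_eq_sub F E c v hπ S hS μ (measurableSet_detLevel F E v hπ S (-4 : ℤ)) hχc.measurable hχ1 3
  rw [show (-(3 : ℤ) + 1) = (-2 : ℤ) by norm_num] at j34
  have j35 := setIntegral_shell_inter_eq_sub F E c v hπ S hS μ (measurableSet_detLevel F E v hπ S (-5 : ℤ)) hχc.measurable hχ1 3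
  rw [show (-(3 : ℤ) + 1) = (-2 : ℤ) by norm_num] at j35
  have j36 := setIntegral_shell_inter_eq_sub F E c v hπ S hS μ (measurableSet_detLevel F E v hπ S (-6 : ℤ)) hχc.measurable hχ1 3
  rw [show (-(3 : ℤ) + 1) = (-2 : ℤ) by norm_num] at j36
  -- Step 5: the values of the lattice integrals: `I(0,m) = μ₀`, `I(1,1) = Cμ₀`, the rest vanish (★ E2c)
  have i01 := hχB0 1 (by norm_num)
  have i02 := hχB0 2 (by norm_num)
  have z12 := setIntegral_levelSet_eq_zero_of_lt F E c v hπ S hS μ hτ hτadd hτs h2F hdψ hβs hββ hβinv0 (k := 1) (m := 2) (by norm_num) (by norm_num)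
  have z13 := setIntegral_levelSet_eq_zero_of_lt F E c v hπ S hS μ hτ hτadd hτs h2F hdψ hβs hββ hβinv0 (k := 1) (m := 3) (by norm_num) (by norm_num)
  have z14 := setIntegral_levelSet_eq_zero_of_lt F E c v hπ S hS μ hτ hτadd hτs h2F hdψ hβs hββ hβinv0 (k := 1) (m := 4) (by norm_num) (by norm_num)
  have z22 := setIntegral_levelSet_eq_zero_diag F E c hcδ hδ v hπ hT₀ hT₀d S hS μ hτ hτadd hτs hτc h2F hTb hTib hεσ hεint hε h2 hψ hdψ hβs hββ hβ0 hβinv0 (k := 2) (by norm_num)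
  have z23 := setIntegral_levelSet_eq_zero_of_lt F E c v hπ S hS μ hτ hτadd hτs h2F hdψ hβs hββ hβinv0 (k := 2) (m := 3) (by norm_num) (by norm_num)
  have z24 := setIntegral_levelSet_eq_zero_of_lt F E c v hπ S hS μ hτ hτadd hτs h2F hdψ hβs hββ hβinv0 (k := 2) (m := 4) (by norm_num) (by norm_num)
  have z25 := setIntegral_levelSet_eq_zero_of_lt F E c v hπ S hS μ hτ hτadd hτs h2F hdψ hβs hββ hβinv0 (k := 2) (m := 5) (by norm_num) (by norm_num)
  have z26 := setIntegral_levelSet_eq_zero_of_lt F E c v hπ S hS μ hτ hτadd hτs h2F hdψ hβs hββ hβinv0 (k := 2) (m := 6) (by norm_num) (by norm_num)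
  have z33 := setIntegral_levelSet_eq_zero_diag F E c hcδ hδ v hπ hT₀ hT₀d S hS μ hτ hτadd hτs hτc h2F hTb hTib hεσ hεint hε h2 hψ hdψ hβs hββ hβ0 hβinv0 (k := 3) (by norm_num)
  have z34 := setIntegral_levelSet_eq_zero_of_lt F E c v hπ S hS μ hτ hτadd hτs h2F hdψ hβs hββ hβinv0 (k := 3) (m := 4) (by norm_num) (by norm_num)
  have z35 := setIntegral_levelSet_eq_zero_of_lt F E c v hπ S hS μ hτ hτadd hτs h2F hdψ hβs hββ hβinv0 (k := 3) (m := 5) (by norm_num) (by norm_num)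
  have z36 := setIntegral_levelSet_eq_zero_of_lt F E c v hπ S hS μ hτ hτadd hτs h2F hdψ hβs hββ hβinv0 (k := 3) (m := 6) (by norm_num) (by norm_num)
  simp only [Nat.cast_ofNat, Nat.cast_one, Int.reduceNeg] at i01 i02 z12 z13 z14 z22 z23 z24 z25 z26 z33 z34 z35 z36 hI11
  -- Step 6: assemble
  rw [e3, e2, e1, e0, s1, s2, s3, j11, j12, j22, j23, j24, j33, j34, j35, j36, i01, i02, hI11, z12, z13, z14, z22, z23, z24, z25, z26, z33, z34,
    z35, z36]
  ring

end Summit.HodgeConjecture.HodgeConjecture.Cruxes.HLiu418.K2LiuGoodPlaceWhittakerUnimodularValue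

end
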